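import Mathlib
import Summits.CriticalPhenomena.PercolationContinuityZ3.Theorems.PercNearOneGluingNoHeavyLowerTailGoodUnitsTools
import Summits.CriticalPhenomena.PercolationContinuityZ3.Theorems.PercNearOneGluingAdditiveGluingGoodStep24Glue
import Summits.CriticalPhenomena.PercolationContinuityZ3.Theorems.PercNearOneGluingAdditiveGluingKnLemma3iOffObserver
import HarnessLib

/-!
# `NoHeavyLowerTail` (stmt-CriticalPhenomena-4575) — GOOD UNITS GLUE, part 2: the composition theorem

Support file (depth prover `prim-nh-dp-blobmono` gen 7, 2026-08-19; `--supports stmt-CriticalPhenomena-4575`).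
No definitions, no named facts, no sorries.

`μ = prodBernoulli w` on `Fin n`, relays `A ∋ b`, observer `o ∉ A`; `G − o` is `restrW {o}ᶜ w`.

* `honestUnits_data` — for an observer whose neighbours are relays or attachment vertices of pairwise disjoint, closed
  Steiner units that are HONEST in `G − o` (e.g. Kozma–Nitzan-good there, `honest_of_knGood`), the four hypotheses of
  `FirstUnitGluing.firstUnit_gluing`
  (determination by disjoint pair sets, honesty, a.s. cover) hold for the unit events
  `{s(o,x) open} ∩ {x reaches A inside its unit}`.
* `goodUnits_gluing` — **good units glue**: then for every `θ > 0`, `μ({o ↔ A} ∩ {o ↮ b}) ≤ θ + t/θ` whenever every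
  relay has `μ(a ↮ b off o) ≤ t` — uniformly in the number of units, their sizes and depths, `|A|` and the rest of
  the graph.  Units known to be good in `G − o`: relays; single vertices with relay neighbours only (KN Thm 4);
  chains = spider legs with relay hairs (KN Thm 5, `SpiderGluing.knGood_of_chain`).
* `goodUnits_gluing_prop` — the proportional form `≤ (t/θ + θ/(1−θ)) · μ(o ↔ A)` (the observer inherits honesty with
  a square-root loss; composes along bounded-depth nestings); `honestUnits_gluing(_prop)` — the same with honesty
  (not goodness) of the units as the hypothesis, which is all the proof uses.

WHY IT WORKS WHERE LAYER RECURSIONS DO NOT (memo SPIDER-GLUING.md on the item): honesty of a unit is evaluated INSIDE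
`G − o` with all other units present — nothing is deleted, so units that are relay CONNECTORS never get cut;
uniformity in the number of units is the disjointness of the events "unit `x` is the first through which `o` reaches a
relay" (`Σ_x u_x P_x ≤ 1`), not a union bound (`ObserverUnionBound`, which costs the weighted degree).
-/

namespace Summit.CriticalPhenomena.PercolationContinuityZ3.Theorems

open MeasureTheory Set
open Literature.Probability.LatticeModels (prodBernoulli prodBernoulli_real_inter_of_determinedBy
  prodBernoulli_real_setOf_mem prodBernoulli_harris_upper_lower)
open Literature.Probability.Percolation

noncomputable section
open Classical

variable {n : ℕ}

namespace SpiderGluing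

/-! ### 5. The theorem: good units glue -/

/-- **Good units glue (Kozma–Nitzan Conjecture 3 for observers whose units are good in `G − o`).**
`μ = prodBernoulli w` on `Fin n`; relays `A ∋ b`, observer `o ∉ A`.  Every neighbour of `o` (`w(o,y) ≠ 0`) lies in the
unit set `X ∌ o`; each `x ∈ X` carries a Steiner set `L x` (`x ∈ L x` when `x ∉ A`; `o ∉ L x`; `L x ∩ A = ∅`; the `L x`
pairwise disjoint; closed: positive pairs from `L x` to non-relays other than `o` stay in `L x`), and every non-relay
unit is Kozma–Nitzan-GOOD in `G − o` (`KNGood (restrW {o}ᶜ w) A _ x b`; e.g. a single vertex with relay neighbours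
only — KN Thm 4 — or the start of a chain/leg with relay hairs — KN Thm 5, `knGood_of_chain`).  If every relay has
`μ(a ↮ b off o) ≤ t`, then for every `θ > 0`:  `μ({o ↔ A} ∩ {o ↮ b}) ≤ θ + t/θ`.
Uniform in the number of units, their sizes/depths, `|A|` and the rest of the graph. [this work] -/
theorem honestUnits_data (w : Sym2 (Fin n) → unitInterval) (A X : Finset (Fin n))
    (o b : Fin n) (hoA : o ∉ A) (hoX : o ∉ X)
    (hX : ∀ y, y ≠ o → w s(o, y) ≠ 0 → y ∈ X)
    (L : Fin n → Finset (Fin n)) (hxL : ∀ x ∈ X, x ∉ A → x ∈ L x) (hoL : ∀ x ∈ X, o ∉ L x)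
    (hLA : ∀ x ∈ X, Disjoint (L x) A) (hLL : ∀ x ∈ X, ∀ x' ∈ X, x ≠ x' → Disjoint (L x) (L x'))
    (hclos : ∀ x ∈ X, ∀ u ∈ L x, ∀ v, v ∉ L x → v ∉ A → v ≠ o → w s(u, v) = 0)
    (t : ℝ) (ht : ∀ a ∈ A, (prodBernoulli w).real (openConnIn (({o} : Set (Fin n))ᶜ) a b)ᶜ ≤ t)
    (hhonest : ∀ x ∈ X, x ∉ A →
      (prodBernoulli w).real ((⋃ a ∈ A, openConnIn (({o} : Set (Fin n))ᶜ) x a) ∩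
          (openConnIn (({o} : Set (Fin n))ᶜ) x b)ᶜ) ≤
        t * (prodBernoulli w).real (⋃ a ∈ A, openConnIn (({o} : Set (Fin n))ᶜ) x a)) :
    ∃ (R : Fin n → Set (BondConfig (Fin n))) (F : Fin n → Finset (Sym2 (Fin n))),
      (∀ x ∈ X, DeterminedBy ({ω : BondConfig (Fin n) | s(o, x) ∈ ω} ∩ R x) (↑(F x) : Set (Sym2 (Fin n)))) ∧
      (↑X : Set (Fin n)).PairwiseDisjoint F ∧
      (∀ x ∈ X, (prodBernoulli w).real ({ω : BondConfig (Fin n) | s(o, x) ∈ ω} ∩ R x ∩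
          (openConnIn (({o} : Set (Fin n))ᶜ) x b)ᶜ) ≤
        t * (prodBernoulli w).real ({ω : BondConfig (Fin n) | s(o, x) ∈ ω} ∩ R x)) ∧
      (prodBernoulli w).real ((⋃ a ∈ A, (openConn o a : Set (BondConfig (Fin n)))) \
          ⋃ x ∈ X, ({ω : BondConfig (Fin n) | s(o, x) ∈ ω} ∩ R x)) = 0 ∧
      (⋃ x ∈ X, ({ω : BondConfig (Fin n) | s(o, x) ∈ ω} ∩ R x)) ⊆
        ⋃ a ∈ A, (openConn o a : Set (BondConfig (Fin n))) := by
  set μ := prodBernoulli w with hμ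
  -- the unit events and their supports
  set R : Fin n → Set (BondConfig (Fin n)) := fun x =>
    {ω : BondConfig (Fin n) | x ∈ A} ∪ ⋃ a ∈ A, openConnIn ((↑(L x) : Set (Fin n)) ∪ {a}) x a with hR
  set F : Fin n → Finset (Sym2 (Fin n)) := fun x =>
    insert s(o, x) (((L x) ×ˢ (L x ∪ A)).image fun q => s(q.1, q.2)) with hF
  -- membership in `F x`
  have memF : ∀ x (e : Sym2 (Fin n)), e ∈ F x ↔ e = s(o, x) ∨ ∃ u ∈ L x, ∃ v, (v ∈ L x ∨ v ∈ A) ∧ e = s(u, v) := by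
    intro x e
    simp only [hF, Finset.mem_insert, Finset.mem_image, Finset.mem_product, Finset.mem_union, Prod.exists]
    constructor
    · rintro (h | ⟨u, v, ⟨hu, hv⟩, rfl⟩)
      · exact Or.inl h
      · exact Or.inr ⟨u, hu, v, hv, rfl⟩
    · rintro (h | ⟨u, hu, v, hv, rfl⟩)
      · exact Or.inl h
      · exact Or.inr ⟨u, v, ⟨hu, hv⟩, rfl⟩
  -- (i) determination
  have hwire : ∀ x ∈ X, ∀ a ∈ A, wireSet ((↑(L x) : Set (Fin n)) ∪ {a}) ⊆ (↑(F x) : Set (Sym2 (Fin n))) := by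
    intro x hx a ha e he
    rw [Finset.mem_coe, memF]
    obtain ⟨hmem, hdiag⟩ := he
    revert hmem hdiag
    refine Sym2.ind (fun u v => ?_) e
    intro hmem hdiag
    have hu := hmem u (Sym2.mem_mk_left u v)
    have hv := hmem v (Sym2.mem_mk_right u v)
    have huv : u ≠ v := fun h => hdiag (by rw [h]; exact Sym2.mk_isDiag_iff.2 rfl)
    simp only [mem_union, Finset.mem_coe, mem_singleton_iff] at hu hv
    right
    rcases hu with hu | rfl
    · rcases hv with hv | rfl
      · exact ⟨u, hu, v, Or.inl hv, rfl⟩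
      · exact ⟨u, hu, v, Or.inr ha, rfl⟩
    · rcases hv with hv | hv
      · exact ⟨v, hv, u, Or.inr ha, Sym2.eq_swap⟩
      · exact absurd hv.symm huv
  have hdet : ∀ x ∈ X, DeterminedBy ({ω : BondConfig (Fin n) | s(o, x) ∈ ω} ∩ R x) (↑(F x) : Set (Sym2 (Fin n))) := by
    intro x hx
    have hcoin : DeterminedBy {ω : BondConfig (Fin n) | s(o, x) ∈ ω} (↑(F x) : Set (Sym2 (Fin n))) := by
      rw [determinedBy_iff]
      intro ω ω' hωω'
      have hmem : s(o, x) ∈ (↑(F x) : Set (Sym2 (Fin n))) := by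
        rw [Finset.mem_coe, memF]; exact Or.inl rfl
      have := Set.ext_iff.1 hωω' s(o, x)
      simp only [mem_inter_iff, hmem, and_true] at this
      simp only [mem_setOf_eq, this]
    refine hcoin.inter (knQ9_determinedBy_union ?_ (goodStep_determinedBy_biUnion A fun a ha => ?_))
    · rw [determinedBy_iff]; intro ω ω' _; simp
    · exact KozmaNitzan.determinedBy_openConnIn_wireSet _ x a (hwire x hx a ha)
  -- (ii) disjoint supports
  have hdisj : (↑X : Set (Fin n)).PairwiseDisjoint F := by
    intro x hx x' hx' hxx'
    rw [Function.onFun, Finset.disjoint_left]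
    intro e he he'
    rw [memF] at he he'
    have hLx := hLL x hx x' hx' hxx'
    rcases he with rfl | ⟨u, hu, v, hv, rfl⟩
    · rcases he' with h | ⟨u', hu', v', hv', h⟩
      · exact hxx' (Sym2.congr_right.1 h)
      · rcases Sym2.eq_iff.1 h with ⟨rfl, rfl⟩ | ⟨rfl, rfl⟩
        · exact hoL x' hx' hu'
        · rcases hv' with hv' | hv'
          · exact hoL x' hx' hv'
          · exact hoA hv'
    · rcases he' with h | ⟨u', hu', v', hv', h⟩
      · rcases Sym2.eq_iff.1 h with ⟨rfl, rfl⟩ | ⟨rfl, rfl⟩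
        · exact hoL x hx hu
        · rcases hv with hv | hv
          · exact hoL x hx hv
          · exact hoA hv
      · rcases Sym2.eq_iff.1 h with ⟨rfl, rfl⟩ | ⟨rfl, rfl⟩
        · exact Finset.disjoint_left.1 hLx hu hu'
        · rcases hv' with hv' | hv'
          · exact Finset.disjoint_left.1 hLx hu hv'
          · exact Finset.disjoint_left.1 (hLA x hx) hu hv'
  -- events off the coin `s(o,x)`
  have hdetD : ∀ x, DeterminedBy (openConnIn (({o} : Set (Fin n))ᶜ) x b : Set (BondConfig (Fin n)))ᶜ
      ((↑({s(o, x)} : Finset (Sym2 (Fin n))) : Set (Sym2 (Fin n))))ᶜ :=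
    fun x => (goodStep_determinedBy_compl (KozmaNitzan.determinedBy_openConnIn_wireSet _ x b subset_rfl)).mono
      (wireSet_compl_subset o x)
  have hdetOff : ∀ x, DeterminedBy (⋃ a ∈ A, (openConnIn (({o} : Set (Fin n))ᶜ) x a : Set (BondConfig (Fin n))))
      ((↑({s(o, x)} : Finset (Sym2 (Fin n))) : Set (Sym2 (Fin n))))ᶜ :=
    fun x => (goodStep_determinedBy_biUnion A fun a _ =>
      KozmaNitzan.determinedBy_openConnIn_wireSet _ x a subset_rfl).mono (wireSet_compl_subset o x)
  -- (iii) honesty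
  have hhon : ∀ x ∈ X, μ.real ({ω : BondConfig (Fin n) | s(o, x) ∈ ω} ∩ R x ∩
      (openConnIn (({o} : Set (Fin n))ᶜ) x b)ᶜ) ≤ t * μ.real ({ω : BondConfig (Fin n) | s(o, x) ∈ ω} ∩ R x) := by
    intro x hx
    have hxo : x ≠ o := fun h => hoX (h ▸ hx)
    by_cases hxA : x ∈ A
    · -- relay unit: `R x = univ`
      have hRx : R x = univ := by
        rw [hR]; ext ω; simp [hxA]
      rw [hRx, inter_univ, real_coin_inter w o x (hdetD x), prodBernoulli_real_setOf_mem]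
      have hw0 : 0 ≤ (w s(o, x) : ℝ) := (w s(o, x)).2.1
      calc (w s(o, x) : ℝ) * μ.real (openConnIn (({o} : Set (Fin n))ᶜ) x b : Set (BondConfig (Fin n)))ᶜ
          ≤ (w s(o, x) : ℝ) * t := mul_le_mul_of_nonneg_left (ht x hxA) hw0
        _ = t * (w s(o, x) : ℝ) := mul_comm _ _
    · -- Steiner unit: `R x` = local reach, a.s. equal to the reach off `o`
      set Rloc : Set (BondConfig (Fin n)) := ⋃ a ∈ A, openConnIn ((↑(L x) : Set (Fin n)) ∪ {a}) x a with hRloc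
      set Roff : Set (BondConfig (Fin n)) := ⋃ a ∈ A, openConnIn (({o} : Set (Fin n))ᶜ) x a with hRoff
      have hRx : R x = Rloc := by
        rw [hR]; ext ω; simp [hxA, hRloc]
      have hsub : Rloc ⊆ Roff := by
        intro ω hω
        rw [hRloc, mem_iUnion₂] at hω
        obtain ⟨a, ha, hω⟩ := hω
        rw [hRoff, mem_iUnion₂]
        refine ⟨a, ha, goodStep24_openConnIn_mono (fun v hv => ?_) x a hω⟩
        rcases hv with hv | hv
        · exact fun h => hoL x hx (by rw [mem_singleton_iff.1 h] at hv; exact hv)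
        · rw [mem_singleton_iff] at hv; subst hv
          exact fun h => hoA (by rw [mem_singleton_iff.1 h] at ha; exact ha)
      have hnull : μ.real (Roff \ Rloc) = 0 := by
        refine le_antisymm ((measureReal_mono (fun ω hω => ?_) (measure_ne_top _ _)).trans
          (real_exists_zero_open w).le) measureReal_nonneg
        obtain ⟨hoff, hloc⟩ := hω
        by_contra hfaith
        simp only [mem_setOf_eq, not_exists, not_and] at hfaith
        rw [hRoff, mem_iUnion₂] at hoff
        obtain ⟨a, ha, hconn⟩ := hoff
        obtain ⟨a', ha', hloc'⟩ := reach_local w A (L x) (hxL x hx hxA) (hLA x hx) (hclos x hx) hfaith ha hconn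
        exact hloc (by rw [hRloc, mem_iUnion₂]; exact ⟨a', ha', hloc'⟩)
      have heq : μ.real Roff = μ.real Rloc := by
        have h1 := measureReal_mono hsub (measure_ne_top (μ := μ) _)
        have h2 : μ.real Roff ≤ μ.real Rloc + μ.real (Roff \ Rloc) := by
          calc μ.real Roff ≤ μ.real (Rloc ∪ (Roff \ Rloc)) :=
                measureReal_mono (fun ω hω => by
                  by_cases h : ω ∈ Rloc
                  · exact Or.inl h
                  · exact Or.inr ⟨hω, h⟩) (measure_ne_top _ _)
            _ ≤ μ.real Rloc + μ.real (Roff \ Rloc) := measureReal_union_le _ _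
        rw [hnull, add_zero] at h2
        exact le_antisymm h2 h1
      have hdetloc : DeterminedBy Rloc ((↑({s(o, x)} : Finset (Sym2 (Fin n))) : Set (Sym2 (Fin n))))ᶜ := by
        refine (goodStep_determinedBy_biUnion A fun a ha => KozmaNitzan.determinedBy_openConnIn_wireSet _ x a ?_).mono
          (wireSet_compl_subset o x)
        refine KozmaNitzan.wireSet_mono fun v hv => ?_
        rcases hv with hv | hv
        · exact fun h => hoL x hx (by rw [mem_singleton_iff.1 h] at hv; exact hv)
        · rw [mem_singleton_iff] at hv; subst hv
          exact fun h => hoA (by rw [mem_singleton_iff.1 h] at ha; exact ha)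
      rw [hRx]
      have step1 : μ.real ({ω : BondConfig (Fin n) | s(o, x) ∈ ω} ∩ Rloc ∩
          (openConnIn (({o} : Set (Fin n))ᶜ) x b)ᶜ) ≤
          μ.real ({ω : BondConfig (Fin n) | s(o, x) ∈ ω} ∩ (Roff ∩ (openConnIn (({o} : Set (Fin n))ᶜ) x b)ᶜ)) :=
        measureReal_mono (fun ω hω => ⟨hω.1.1, hsub hω.1.2, hω.2⟩) (measure_ne_top _ _)
      rw [real_coin_inter w o x ((hdetOff x).inter (hdetD x))] at step1
      rw [real_coin_inter w o x hdetloc, ← heq]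
      have hw0 : 0 ≤ (w s(o, x) : ℝ) := (w s(o, x)).2.1
      have hon := hhonest x hx hxA
      calc μ.real ({ω : BondConfig (Fin n) | s(o, x) ∈ ω} ∩ Rloc ∩ (openConnIn (({o} : Set (Fin n))ᶜ) x b)ᶜ)
          ≤ (w s(o, x) : ℝ) * μ.real (Roff ∩ (openConnIn (({o} : Set (Fin n))ᶜ) x b)ᶜ) := step1
        _ ≤ (w s(o, x) : ℝ) * (t * μ.real Roff) := mul_le_mul_of_nonneg_left hon hw0
        _ = t * ((w s(o, x) : ℝ) * μ.real Roff) := by ring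
  -- (iv) cover
  have hcov : μ.real ((⋃ a ∈ A, (openConn o a : Set (BondConfig (Fin n)))) \
      ⋃ x ∈ X, ({ω : BondConfig (Fin n) | s(o, x) ∈ ω} ∩ R x)) = 0 := by
    refine le_antisymm ((measureReal_mono (fun ω hω => ?_) (measure_ne_top _ _)).trans
      (real_exists_zero_open w).le) measureReal_nonneg
    obtain ⟨hconn, hnot⟩ := hω
    by_contra hfaith
    simp only [mem_setOf_eq, not_exists, not_and] at hfaith
    rw [mem_iUnion₂] at hconn
    obtain ⟨a, ha, hoa⟩ := hconn
    obtain ⟨y, hyo, hyω, hyw, hya⟩ := first_edge w hoA hfaith ha hoa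
    have hyX : y ∈ X := hX y hyo hyw
    apply hnot
    rw [mem_iUnion₂]
    refine ⟨y, hyX, hyω, ?_⟩
    by_cases hyA : y ∈ A
    · exact Or.inl hyA
    · obtain ⟨a', ha', hloc⟩ := reach_local w A (L y) (hxL y hyX hyA) (hLA y hyX) (hclos y hyX) hfaith ha hya
      right
      rw [mem_iUnion₂]
      exact ⟨a', ha', hloc⟩
  -- (v) the unit events imply `o ↔ A`
  have hsub : (⋃ x ∈ X, ({ω : BondConfig (Fin n) | s(o, x) ∈ ω} ∩ R x)) ⊆
      ⋃ a ∈ A, (openConn o a : Set (BondConfig (Fin n))) := by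
    intro ω hω
    rw [mem_iUnion₂] at hω
    obtain ⟨x, hx, hcoin, hRx⟩ := hω
    have hxo : x ≠ o := fun h => hoX (h ▸ hx)
    have hadj : (openGraph ω).Adj o x := (openGraph_adj ω o x).2 ⟨hcoin, hxo.symm⟩
    rw [mem_iUnion₂]
    rcases hRx with hxA | hloc
    · exact ⟨x, hxA, hadj.reachable⟩
    · rw [mem_iUnion₂] at hloc
      obtain ⟨a, ha, hloc⟩ := hloc
      exact ⟨a, ha, hadj.reachable.trans (KNPreFKG.reachable_of_openConnIn hloc)⟩
  exact ⟨R, F, hdet, hdisj, hhon, hcov, hsub⟩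

/-- **Good units glue (Kozma–Nitzan Conjecture 3 for observers whose units are good in `G − o`).**
`μ = prodBernoulli w` on `Fin n`; relays `A ∋ b`, observer `o ∉ A`.  Every neighbour of `o` (`w(o,y) ≠ 0`) lies in the
unit set `X ∌ o`; each `x ∈ X` carries a Steiner set `L x` (`x ∈ L x` when `x ∉ A`; `o ∉ L x`; `L x ∩ A = ∅`; the `L x`
pairwise disjoint; closed: positive pairs from `L x` to non-relays other than `o` stay in `L x`), and every non-relay
unit is Kozma–Nitzan-GOOD in `G − o` (`KNGood (restrW {o}ᶜ w) A _ x b`; e.g. a single vertex with relay neighbours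
only — KN Thm 4 — or the start of a chain/leg with relay hairs — KN Thm 5, `knGood_of_chain`).  If every relay has
`μ(a ↮ b off o) ≤ t`, then for every `θ > 0`:  `μ({o ↔ A} ∩ {o ↮ b}) ≤ θ + t/θ`.
Uniform in the number of units, their sizes/depths, `|A|` and the rest of the graph. [this work] -/
theorem goodUnits_gluing (w : Sym2 (Fin n) → unitInterval) (A X : Finset (Fin n)) (hA : A.Nonempty)
    (o b : Fin n) (hoA : o ∉ A) (hb : b ∈ A) (hoX : o ∉ X)
    (hX : ∀ y, y ≠ o → w s(o, y) ≠ 0 → y ∈ X)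
    (L : Fin n → Finset (Fin n)) (hxL : ∀ x ∈ X, x ∉ A → x ∈ L x) (hoL : ∀ x ∈ X, o ∉ L x)
    (hLA : ∀ x ∈ X, Disjoint (L x) A) (hLL : ∀ x ∈ X, ∀ x' ∈ X, x ≠ x' → Disjoint (L x) (L x'))
    (hclos : ∀ x ∈ X, ∀ u ∈ L x, ∀ v, v ∉ L x → v ∉ A → v ≠ o → w s(u, v) = 0)
    (hgood : ∀ x ∈ X, x ∉ A → KNGood (restrW (({o} : Set (Fin n))ᶜ) w) A hA x b)
    (t : ℝ) (ht0 : 0 ≤ t)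
    (ht : ∀ a ∈ A, (prodBernoulli w).real (openConnIn (({o} : Set (Fin n))ᶜ) a b)ᶜ ≤ t)
    (θ : ℝ) (hθ : 0 < θ) :
    (prodBernoulli w).real ((⋃ a ∈ A, (openConn o a : Set (BondConfig (Fin n)))) ∩ (openConn o b)ᶜ) ≤
      θ + t / θ := by
  obtain ⟨R, F, hdet, hdisj, hhon, hcov, _⟩ :=
    honestUnits_data w A X o b hoA hoX hX L hxL hoL hLA hLL hclos t ht
      fun x hx hxA => honest_of_knGood w A hA hoA hb (fun h => hoX (h ▸ hx)) ht (hgood x hx hxA)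
  exact FirstUnitGluing.firstUnit_gluing w A X o b hoX R F hdet hdisj t ht0 hhon hcov θ hθ

/-- **Proportional form** (the observer inherits HONESTY): under the hypotheses of `goodUnits_gluing`, for every
`θ ∈ (0,1)`:  `μ({o ↔ A} ∩ {o ↮ b}) ≤ (t/θ + θ/(1−θ)) · μ(o ↔ A)`  (e.g. `≤ 4√t · μ(o ↔ A)` for `t ≤ 1/4`,
`θ = √t`).  So an observer whose units are honest in `G − o` is itself honest in `G` with a square-root loss —
the statement composes along bounded-depth nestings of units. [this work] -/
theorem goodUnits_gluing_prop (w : Sym2 (Fin n) → unitInterval) (A X : Finset (Fin n)) (hA : A.Nonempty)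
    (o b : Fin n) (hoA : o ∉ A) (hb : b ∈ A) (hoX : o ∉ X)
    (hX : ∀ y, y ≠ o → w s(o, y) ≠ 0 → y ∈ X)
    (L : Fin n → Finset (Fin n)) (hxL : ∀ x ∈ X, x ∉ A → x ∈ L x) (hoL : ∀ x ∈ X, o ∉ L x)
    (hLA : ∀ x ∈ X, Disjoint (L x) A) (hLL : ∀ x ∈ X, ∀ x' ∈ X, x ≠ x' → Disjoint (L x) (L x'))
    (hclos : ∀ x ∈ X, ∀ u ∈ L x, ∀ v, v ∉ L x → v ∉ A → v ≠ o → w s(u, v) = 0)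
    (hgood : ∀ x ∈ X, x ∉ A → KNGood (restrW (({o} : Set (Fin n))ᶜ) w) A hA x b)
    (t : ℝ) (ht0 : 0 ≤ t)
    (ht : ∀ a ∈ A, (prodBernoulli w).real (openConnIn (({o} : Set (Fin n))ᶜ) a b)ᶜ ≤ t)
    (θ : ℝ) (hθ : 0 < θ) (hθ1 : θ < 1) :
    (prodBernoulli w).real ((⋃ a ∈ A, (openConn o a : Set (BondConfig (Fin n)))) ∩ (openConn o b)ᶜ) ≤
      (t / θ + θ / (1 - θ)) * (prodBernoulli w).real (⋃ a ∈ A, (openConn o a : Set (BondConfig (Fin n)))) := by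
  obtain ⟨R, F, hdet, hdisj, hhon, hcov, hsub⟩ :=
    honestUnits_data w A X o b hoA hoX hX L hxL hoL hLA hLL hclos t ht
      fun x hx hxA => honest_of_knGood w A hA hoA hb (fun h => hoX (h ▸ hx)) ht (hgood x hx hxA)
  have key := FirstUnitGluing.firstUnit_gluing_prop w A X o b hoX R F hdet hdisj t ht0 hhon hcov θ hθ hθ1
  have hmono : (prodBernoulli w).real (⋃ x ∈ X, ({ω : BondConfig (Fin n) | s(o, x) ∈ ω} ∩ R x)) ≤
      (prodBernoulli w).real (⋃ a ∈ A, (openConn o a : Set (BondConfig (Fin n)))) :=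
    measureReal_mono hsub (measure_ne_top _ _)
  have hc : 0 ≤ t / θ + θ / (1 - θ) := add_nonneg (div_nonneg ht0 hθ.le) (div_nonneg hθ.le (by linarith))
  exact key.trans (mul_le_mul_of_nonneg_left hmono hc)

/-- **Honest units glue, proportional form** — the composition principle with HONESTY (not goodness) as the unit
hypothesis: if every non-relay unit `x` satisfies `μ(x ↔ A off o, x ↮ b off o) ≤ t · μ(x ↔ A off o)` and every relay has
`μ(a ↮ b off o) ≤ t`, then `μ({o ↔ A} ∩ {o ↮ b}) ≤ (t/θ + θ/(1−θ)) · μ(o ↔ A)` for every `θ ∈ (0,1)`.  Since the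
conclusion is again an honesty statement (in `G`, with modulus `t/θ + θ/(1−θ)`), the principle composes along
nestings of units (with the hub bridge `SpiderGluing.bridge` to pass from `G − o` to `G − o − x`). [this work] -/
theorem honestUnits_gluing_prop (w : Sym2 (Fin n) → unitInterval) (A X : Finset (Fin n))
    (o b : Fin n) (hoA : o ∉ A) (hoX : o ∉ X)
    (hX : ∀ y, y ≠ o → w s(o, y) ≠ 0 → y ∈ X)
    (L : Fin n → Finset (Fin n)) (hxL : ∀ x ∈ X, x ∉ A → x ∈ L x) (hoL : ∀ x ∈ X, o ∉ L x)
    (hLA : ∀ x ∈ X, Disjoint (L x) A) (hLL : ∀ x ∈ X, ∀ x' ∈ X, x ≠ x' → Disjoint (L x) (L x'))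
    (hclos : ∀ x ∈ X, ∀ u ∈ L x, ∀ v, v ∉ L x → v ∉ A → v ≠ o → w s(u, v) = 0)
    (t : ℝ) (ht0 : 0 ≤ t)
    (ht : ∀ a ∈ A, (prodBernoulli w).real (openConnIn (({o} : Set (Fin n))ᶜ) a b)ᶜ ≤ t)
    (hhonest : ∀ x ∈ X, x ∉ A →
      (prodBernoulli w).real ((⋃ a ∈ A, openConnIn (({o} : Set (Fin n))ᶜ) x a) ∩
          (openConnIn (({o} : Set (Fin n))ᶜ) x b)ᶜ) ≤
        t * (prodBernoulli w).real (⋃ a ∈ A, openConnIn (({o} : Set (Fin n))ᶜ) x a))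
    (θ : ℝ) (hθ : 0 < θ) (hθ1 : θ < 1) :
    (prodBernoulli w).real ((⋃ a ∈ A, (openConn o a : Set (BondConfig (Fin n)))) ∩ (openConn o b)ᶜ) ≤
      (t / θ + θ / (1 - θ)) * (prodBernoulli w).real (⋃ a ∈ A, (openConn o a : Set (BondConfig (Fin n)))) := by
  obtain ⟨R, F, hdet, hdisj, hhon, hcov, hsub⟩ :=
    honestUnits_data w A X o b hoA hoX hX L hxL hoL hLA hLL hclos t ht hhonest
  have key := FirstUnitGluing.firstUnit_gluing_prop w A X o b hoX R F hdet hdisj t ht0 hhon hcov θ hθ hθ1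
  have hmono : (prodBernoulli w).real (⋃ x ∈ X, ({ω : BondConfig (Fin n) | s(o, x) ∈ ω} ∩ R x)) ≤
      (prodBernoulli w).real (⋃ a ∈ A, (openConn o a : Set (BondConfig (Fin n)))) :=
    measureReal_mono hsub (measure_ne_top _ _)
  have hc : 0 ≤ t / θ + θ / (1 - θ) := add_nonneg (div_nonneg ht0 hθ.le) (div_nonneg hθ.le (by linarith))
  exact key.trans (mul_le_mul_of_nonneg_left hmono hc)

/-- **Honest units glue, `θ`-form**: same hypotheses, `μ({o ↔ A} ∩ {o ↮ b}) ≤ θ + t/θ` for every `θ > 0`. [this work] -/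
theorem honestUnits_gluing (w : Sym2 (Fin n) → unitInterval) (A X : Finset (Fin n))
    (o b : Fin n) (hoA : o ∉ A) (hoX : o ∉ X)
    (hX : ∀ y, y ≠ o → w s(o, y) ≠ 0 → y ∈ X)
    (L : Fin n → Finset (Fin n)) (hxL : ∀ x ∈ X, x ∉ A → x ∈ L x) (hoL : ∀ x ∈ X, o ∉ L x)
    (hLA : ∀ x ∈ X, Disjoint (L x) A) (hLL : ∀ x ∈ X, ∀ x' ∈ X, x ≠ x' → Disjoint (L x) (L x'))
    (hclos : ∀ x ∈ X, ∀ u ∈ L x, ∀ v, v ∉ L x → v ∉ A → v ≠ o → w s(u, v) = 0)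
    (t : ℝ) (ht0 : 0 ≤ t)
    (ht : ∀ a ∈ A, (prodBernoulli w).real (openConnIn (({o} : Set (Fin n))ᶜ) a b)ᶜ ≤ t)
    (hhonest : ∀ x ∈ X, x ∉ A →
      (prodBernoulli w).real ((⋃ a ∈ A, openConnIn (({o} : Set (Fin n))ᶜ) x a) ∩
          (openConnIn (({o} : Set (Fin n))ᶜ) x b)ᶜ) ≤
        t * (prodBernoulli w).real (⋃ a ∈ A, openConnIn (({o} : Set (Fin n))ᶜ) x a))
    (θ : ℝ) (hθ : 0 < θ) :
    (prodBernoulli w).real ((⋃ a ∈ A, (openConn o a : Set (BondConfig (Fin n)))) ∩ (openConn o b)ᶜ) ≤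
      θ + t / θ := by
  obtain ⟨R, F, hdet, hdisj, hhon, hcov, _⟩ :=
    honestUnits_data w A X o b hoA hoX hX L hxL hoL hLA hLL hclos t ht hhonest
  exact FirstUnitGluing.firstUnit_gluing w A X o b hoX R F hdet hdisj t ht0 hhon hcov θ hθ

end SpiderGluing

end

end Summit.CriticalPhenomena.PercolationContinuityZ3.Theorems
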